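import Summits.RiemannHypothesis.RiemannHypothesis.Theorems.LagariasZeroFreeDoorUnconditional
import Literature.NumberTheory.LFunctions.SuzukiWeilHatValueRelational
import HarnessLib

/-!
# «RH ⟺ Θ_ξ has no pole in ℂ₊» — the kernel form of «RH ⟺ κ = 0» (cell rh-split, card `SPLIT-dbr-neg.md` §14.3 (iii) / 14.8)

Modulo the ONE remaining input of the Lagarias zero-free door, `MinModulusCircles` (= Hadamard's printed
minimum-modulus theorem for the order-1 entire function `E_ξ`, `Literature.Analysis.Complex.Titchmarsh1939_thm_8_711`,
via `minModulusCircles_of_hadamard`):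

* `riemannHypothesis_iff_upperZeros_subset (hmin : MinModulusCircles) :
    RiemannHypothesis ↔ ∀ z, 0 < z.im → lagariasE z = 0 → lagariasXiA z = 0` —
  RH holds iff every zero of `E_ξ(z) = ξ(1/2 − iz) + ξ′(1/2 − iz)` in the upper half-plane is a zero parameter of
  `A(z) = ξ(1/2 − iz)` (necessarily a MULTIPLE off-line one), i.e. iff `Θ_ξ = E_ξ♯/E_ξ` has NO POLE in `ℂ₊`
  (at a common zero of `A` and `E_ξ`, `Θ_ξ → −1`: `tendsto_lagariasTheta_neg_one_of_lagariasXiA_eq_zero`).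
  The right side is formally weaker than «`E_ξ` zero-free on `ℂ₊`» (`zeroFreeDoorIff_of_minModulusCircles`); the gap is
  closed by the hypothesis-free contractivity criterion `riemannHypothesis_iff_lagariasTheta_contractive`.
* `exists_pole_of_not_rh` — contrapositive: if RH fails, `Θ_ξ` has a genuine pole in `ℂ₊`.

No Blaschke products are used.  RH-FREE lemmas + RH-EQUIVALENT·CONDITIONAL-on-`MinModulusCircles` door; nothing here
is a claim about the truth of RH.  (Scratch of record: `run/shared/lean/pub/rh-split/rh-split-dbr-neg/SketchG6e.lean`.)

FILING (rh-split-typer-2 g4): this is the seat's carve `HOME/rh-split-dbr-neg/carve/LagariasThetaNoPole.lean` (sha16 b002a1302128385b;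
= `SketchG6e.lean` 61d35149ed31eb06, referee rh-split-ref g3 replay #5 PASS 2026-08-27T05:55:12Z) with the three door/bookkeeping decl
blocks byte-verbatim, the local copy of `tendsto_lagariasTheta_neg_one_of_lagariasXiA_eq_zero` DROPPED in favour of the landed
`Literature.NumberTheory.LFunctions.tendsto_lagariasTheta_neg_one_of_lagariasXiA_eq_zero` (`SuzukiWeilHatValueRelational.lean`, as the
seat instructed), and ONE new section «Unconditional forms»: since `MinModulusCircles` is now a TREE THEOREM
(`LagariasZeroFreeDoorUnconditional.minModulusCircles_holds`, from Hadamard's minimum-modulus theorem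
`Literature.Analysis.Complex.Titchmarsh1939_thm_8_711_holds`), the door specialises to the HYPOTHESIS-FREE kernel RH-equivalence
`riemannHypothesis_iff_upperZeros_subset_holds : RH ↔ ∀ z, 0 < Im z → E_ξ z = 0 → A z = 0` («RH ⟺ Θ_ξ has no pole in ℂ₊», i.e.
«RH ⟺ κ = 0») and `exists_pole_of_not_rh_holds`.  RH-EQUIVALENT, PROVED; it certifies nothing about RH.
-/

noncomputable section

-- D-0017: `Summit.<S>.<S>.…` is the designed namespace of a single-problem summit.
set_option linter.dupNamespace false

open Set Filter Metric Complex Topology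
open Literature.Analysis.DeBrangesSpaces Literature.NumberTheory.LFunctions
open Summit.RiemannHypothesis.RiemannHypothesis.Theorems.LagariasZeroFreeDoor
open Summit.RiemannHypothesis.RiemannHypothesis.Theorems.LagariasZeroFreeDoorStrip
open Summit.RiemannHypothesis.RiemannHypothesis.Theorems.LagariasThetaContractive

namespace Summit.RiemannHypothesis.RiemannHypothesis.Theorems.LagariasThetaNoPole

/-- RH-FREE.  If every zero of `E_ξ` in `ℂ₊` is a zero of `A`, the extension `Θ̃` (`thetaTilde`) is complex
differentiable at every point of `ℂ₊` (removable singularities with value `−1`). -/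
theorem differentiableAt_thetaTilde_of_subset
    (h : ∀ z : ℂ, 0 < z.im → lagariasE z = 0 → lagariasXiA z = 0) {w : ℂ} (hw : 0 < w.im) :
    DifferentiableAt ℂ thetaTilde w := by
  have hΘ : lagariasTheta = fun z ↦ sharp lagariasE z / lagariasE z := rfl
  -- `Θ_ξ` is differentiable at every point where `E_ξ ≠ 0`, and `Θ̃ = Θ_ξ` near such a point
  have hdiffΘ : ∀ u : ℂ, lagariasE u ≠ 0 → DifferentiableAt ℂ thetaTilde u := by
    intro u hu
    have hopen : IsOpen {v : ℂ | lagariasE v ≠ 0} := isOpen_ne_fun continuous_lagariasE continuous_const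
    have hev : thetaTilde =ᶠ[𝓝 u] lagariasTheta :=
      Filter.eventuallyEq_of_mem (hopen.mem_nhds hu) fun v hv => thetaTilde_eq_of_ne hv
    have hΘu : DifferentiableAt ℂ lagariasTheta u := by
      rw [hΘ]
      exact ((differentiable_sharp differentiable_lagariasE) u).div (differentiable_lagariasE u) hu
    exact hev.differentiableAt_iff.2 hΘu
  by_cases hE : lagariasE w = 0
  · -- removable singularity at a common zero of `E_ξ` and `A`
    have hA : lagariasXiA w = 0 := h w hw hE
    have hlim : Tendsto lagariasTheta (𝓝[≠] w) (𝓝 (-1)) := tendsto_lagariasTheta_neg_one_of_lagariasXiA_eq_zero hA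
    have hval : thetaTilde w = -1 := by
      rw [thetaTilde, if_pos hE]; exact hlim.limUnder_eq
    have hev : ∀ᶠ u in 𝓝[≠] w, thetaTilde u = lagariasTheta u :=
      (lagariasE_eventually_ne_zero w).mono fun u hu => thetaTilde_eq_of_ne hu
    have hcont : ContinuousAt thetaTilde w := by
      rw [← continuousWithinAt_compl_self, ContinuousWithinAt, hval]
      exact hlim.congr' (hev.mono fun u hu => hu.symm)
    have hpd : ∀ᶠ u in 𝓝[≠] w, DifferentiableAt ℂ thetaTilde u :=
      (lagariasE_eventually_ne_zero w).mono fun u hu => hdiffΘ u hu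
    exact (analyticAt_of_differentiable_on_punctured_nhds_of_continuousAt hpd hcont).differentiableAt
  · exact hdiffΘ w hE

/-- **RH-FREE·CONDITIONAL-on-`MinModulusCircles`.  «RH ⟺ Θ_ξ has no pole in ℂ₊» (kernel form of «RH ⟺ κ = 0»).**
RH holds iff every zero of `E_ξ(z) = ξ(1/2 − iz) + ξ′(1/2 − iz)` in the upper half-plane is a zero of
`A(z) = ξ(1/2 − iz)` (necessarily a MULTIPLE off-line zero parameter, where `Θ_ξ → −1` and has no pole).  The right
side is formally weaker than «`E_ξ` zero-free on `ℂ₊`» (`zeroFreeDoorIff_of_minModulusCircles`); what closes the gap is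
the hypothesis-free contractivity criterion `riemannHypothesis_iff_lagariasTheta_contractive`. -/
theorem riemannHypothesis_iff_upperZeros_subset (hmin : MinModulusCircles) :
    RiemannHypothesis ↔ ∀ z : ℂ, 0 < z.im → lagariasE z = 0 → lagariasXiA z = 0 := by
  constructor
  · intro hRH z hz hE
    exact absurd hE ((zeroFreeDoorIff_of_minModulusCircles hmin).1 hRH z hz)
  · intro h
    refine riemannHypothesis_iff_lagariasTheta_contractive.2 fun z hz hE => ?_
    -- `Θ̃` is holomorphic on the open strip and continuous on its closure
    have hopen : IsOpen {w : ℂ | 0 < w.im} := isOpen_lt continuous_const continuous_im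
    have hTdiff : DifferentiableOn ℂ thetaTilde {w : ℂ | 0 < w.im} :=
      fun w hw => (differentiableAt_thetaTilde_of_subset h hw).differentiableWithinAt
    have hTcont : ∀ w : ℂ, 0 ≤ w.im → ContinuousAt thetaTilde w := by
      intro w hw
      rcases hw.lt_or_eq with hw | hw
      · exact (differentiableAt_thetaTilde_of_subset h hw).continuousAt
      · have hwre : w = ((w.re : ℝ) : ℂ) := by
          apply Complex.ext <;> simp [hw.symm]
        obtain ⟨q, r, hr, hqd, hqeq, -⟩ := thetaTilde_eqOn_ball w.re
        rw [hwre]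
        have hq : ContinuousAt q (w.re : ℂ) := (hqd _ (mem_ball_self hr)).continuousAt
        exact hq.congr (Filter.eventuallyEq_of_mem (isOpen_ball.mem_nhds (mem_ball_self hr))
          fun u hu => (hqeq u hu).symm)
    have hS : DiffContOnCl ℂ thetaTilde (im ⁻¹' Ioo 0 (1 / 2)) := by
      refine ⟨hTdiff.mono fun w hw => hw.1, ?_⟩
      rw [closure_preimage_im, closure_Ioo (by norm_num : (0 : ℝ) ≠ 1 / 2)]
      exact fun w hw => (hTcont w hw.1).continuousWithinAt
    have hSb : ∀ w : ℂ, 0 ≤ w.im → lagariasE w ≠ 0 → thetaTilde w = lagariasTheta w * (fun _ : ℂ ↦ (1 : ℂ)) w :=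
      fun w _ hw => by rw [mul_one]; exact thetaTilde_eq_of_ne hw
    have hb : ∀ w : ℂ, 0 ≤ w.im → ‖(fun _ : ℂ ↦ (1 : ℂ)) w‖ ≤ 1 := fun w _ => by simp
    have hbc : ∀ x : ℝ, ContinuousAt (fun _ : ℂ ↦ (1 : ℂ)) x := fun x => continuousAt_const
    have key := norm_lagariasTheta_mul_le_one hmin hS hSb hb hbc hz hE
    simpa using key

/-- Bookkeeping.  Contrapositive reading: if RH fails then `Θ_ξ` has a GENUINE POLE in `ℂ₊` — a zero of `E_ξ` in the
upper half-plane at which `ξ(1/2 − iz) ≠ 0` (so `κ ≥ 1`).  RH-FREE·CONDITIONAL-on-`MinModulusCircles`. -/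
theorem exists_pole_of_not_rh (hmin : MinModulusCircles) (hRH : ¬ RiemannHypothesis) :
    ∃ z : ℂ, 0 < z.im ∧ lagariasE z = 0 ∧ lagariasXiA z ≠ 0 := by
  by_contra hno
  push Not at hno
  exact hRH ((riemannHypothesis_iff_upperZeros_subset hmin).2 fun z hz hE => hno z hz hE)

/-! ## Unconditional forms (`MinModulusCircles` is a tree theorem: `minModulusCircles_holds`) -/

/-- **«RH ⟺ Θ_ξ has no pole in ℂ₊» («RH ⟺ κ = 0»), HYPOTHESIS-FREE.**  RH holds iff every zero of
`E_ξ(z) = ξ(1/2 − iz) + ξ′(1/2 − iz)` in the open upper half-plane is a zero of `A(z) = ξ(1/2 − iz)`.  A KERNEL RH-EQUIVALENCE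
with no named input (the door above at `LagariasZeroFreeDoorUnconditional.minModulusCircles_holds`); RH-EQUIVALENT, PROVED; it
certifies nothing about RH. -/
theorem riemannHypothesis_iff_upperZeros_subset_holds :
    RiemannHypothesis ↔ ∀ z : ℂ, 0 < z.im → lagariasE z = 0 → lagariasXiA z = 0 :=
  riemannHypothesis_iff_upperZeros_subset LagariasZeroFreeDoorUnconditional.minModulusCircles_holds

/-- Bookkeeping, HYPOTHESIS-FREE: if RH fails then `Θ_ξ` has a genuine pole in `ℂ₊` — a zero of `E_ξ` in the upper
half-plane at which `ξ(1/2 − iz) ≠ 0`. RH-FREE implication (contrapositive of the door). -/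
theorem exists_pole_of_not_rh_holds (hRH : ¬ RiemannHypothesis) :
    ∃ z : ℂ, 0 < z.im ∧ lagariasE z = 0 ∧ lagariasXiA z ≠ 0 :=
  exists_pole_of_not_rh LagariasZeroFreeDoorUnconditional.minModulusCircles_holds hRH

end Summit.RiemannHypothesis.RiemannHypothesis.Theorems.LagariasThetaNoPole

end
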